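import Literature.NumberTheory.EllipticCurves.HeckeEisensteinWeightOneForm
import Literature.NumberTheory.LFunctions.DirichletLAtZero
import Literature.NumberTheory.LFunctions.GeneralizedBernoulliNumbers
import HarnessLib

/-!
# Constant terms of Hecke's weight-one Eisenstein series at the cusps prime to the level

Topic `Literature/NumberTheory/EllipticCurves`; namespace
`Literature.NumberTheory.EllipticCurves.ModularForms`.  THEOREMS only; no named fact.

For an odd character `χ` modulo `M` and `A = (a b; c d) ∈ SL₂(ℤ)` with `c` a unit modulo `M`
(a cusp "of the second kind"), the constant term `heckeOneCusp χ A` of `G̃_χ(·,0) ∣₁ A`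
(`HeckeEisensteinWeightOneForm`) is

  `heckeOneCusp χ A = (2πi/M) · χ̄(c) · B_{1,χ}`                    (`heckeOneCusp_of_isUnit`)

(`B_{1,χ}` the generalised Bernoulli number of `GeneralizedBernoulliNumbers`).  Proof: in
`∑_{v₀} W_A(v₀) congrConst(v₀)` the terms of the first kind vanish (`M ∣ c₀` and
`M ∣ (v₀A⁻¹)₀` force `v₀ ≡ 0`, of weight `χ(0) = 0`); for the second kind the index pairs with
`(v₀A⁻¹)₀ ≡ 0` are `v₀ ≡ (t c, t d)`, of weight `χ(t)` with `t ≡ c₀ c⁻¹`, so the sum is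
`(2(-iπ)/M) χ̄(c) ∑_t χ(t) ζ_odd(t/M, 0) = (2(-iπ)/M) χ̄(c) (-B_{1,χ})` by
`ζ_odd(x, 0) = 1/2 - x` (`DirichletLAtZero`).  Also: `LFunction_zero_eq_neg_generalizedBernoulli_one`
(`L(0, χ) = -B_{1,χ}` for odd `χ`).

## References

* E. Hecke, *Theorie der Eisensteinschen Reihen höherer Stufe…*, Abh. Math. Sem. Hamburg 5
  (1927), §2. [Hecke1927]
* L. C. Washington, *Introduction to Cyclotomic Fields*, 2nd ed., GTM 83 (1997), Thm. 4.2.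
  [Washington1997]
-/

noncomputable section

open Complex UpperHalfPlane Filter Finset CongruenceSubgroup ModularForm Matrix HurwitzZeta
  Literature.NumberTheory.LFunctions
open scoped Real Topology MatrixGroups

namespace Literature.NumberTheory.EllipticCurves.ModularForms

section LZero

variable {M : ℕ} [NeZero M] (χ : DirichletCharacter ℂ M)

/-- `B_{1,χ} = (1/M) ∑_j j χ(j)` for `χ ≠ 1` (`B₁(X) = X - 1/2` and `∑ χ = 0`).
[cite: Washington1997, Thm. 4.2] -/
theorem generalizedBernoulli_one_eq (hχ : χ ≠ 1) :
    generalizedBernoulli 1 χ = (∑ j : ZMod M, (j.val : ℂ) * χ j) / M := by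
  have hM0 : (M : ℂ) ≠ 0 := by exact_mod_cast NeZero.ne M
  have h0 : ∑ j : ZMod M, χ j = 0 := MulChar.sum_eq_zero_of_ne_one hχ
  have hcoef : ∀ j : ZMod M, (algebraMap ℚ ℂ) (genBernoulliCoeff 1 M j.val) = (j.val : ℂ) / M - 2⁻¹ := by
    intro j
    rw [algebraMap_genBernoulliCoeff le_rfl]
    simp [Polynomial.bernoulli_one]
  rw [generalizedBernoulli_eq_sum]
  simp_rw [hcoef, mul_sub, Finset.sum_sub_distrib, ← Finset.sum_mul, h0, zero_mul, sub_zero,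
    Finset.sum_div]
  exact Finset.sum_congr rfl fun j _ ↦ by ring

/-- **`L(0, χ) = -B_{1,χ}`** for an odd Dirichlet character. [cite: Washington1997, Thm. 4.2] -/
theorem LFunction_zero_eq_neg_generalizedBernoulli_one (hodd : χ.Odd) :
    χ.LFunction 0 = -generalizedBernoulli 1 χ := by
  have h1 : χ (-1) = -1 := hodd
  have hΦ : Function.Odd (fun j : ZMod M ↦ χ j) := fun j ↦ by
    show χ (-j) = -χ j
    rw [← neg_one_mul, map_mul, h1, neg_one_mul]
  change ZMod.LFunction (fun j : ZMod M ↦ χ j) 0 = _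
  rw [LValueZero.LFunction_apply_zero_of_odd hΦ,
    generalizedBernoulli_one_eq χ (ne_one_of_odd χ hodd), neg_div]

/-- `ζ_odd(j/M, 0) χ(j)` summed: **`∑_j χ(j) ζ_odd(j/M, 0) = -B_{1,χ}`** (odd `χ`).
[cite: Washington1997, Thm. 4.2] -/
theorem sum_mul_hurwitzZetaOdd_zero (hodd : χ.Odd) :
    ∑ j : ZMod M, χ j * hurwitzZetaOdd (ZMod.toAddCircle j) 0 = -generalizedBernoulli 1 χ := by
  have hM0 : (M : ℂ) ≠ 0 := by exact_mod_cast NeZero.ne M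
  have hMr : (0 : ℝ) < M := by exact_mod_cast NeZero.pos M
  have hχ := ne_one_of_odd χ hodd
  have h0 : ∑ j : ZMod M, χ j = 0 := MulChar.sum_eq_zero_of_ne_one hχ
  have hval : ∀ j : ZMod M, χ j * hurwitzZetaOdd (ZMod.toAddCircle j) 0 =
      χ j * (1 / 2 - (j.val : ℂ) / M) := by
    intro j
    by_cases hj : j = 0
    · subst hj
      have hM1 : M ≠ 1 := by
        rintro rfl
        exact hχ (DirichletCharacter.level_one χ)
      haveI : Nontrivial (ZMod M) := ZMod.nontrivial_iff.mpr hM1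
      rw [MulChar.map_zero, zero_mul, zero_mul]
    · have hv0 : 0 < j.val := Nat.pos_of_ne_zero fun h ↦ hj ((ZMod.val_eq_zero j).mp h)
      have hx0 : (0 : ℝ) < j.val / M := div_pos (by exact_mod_cast hv0) hMr
      have hx1 : (j.val : ℝ) / M < 1 := (div_lt_one hMr).mpr (by exact_mod_cast ZMod.val_lt j)
      rw [ZMod.toAddCircle_apply, LValueZero.hurwitzZetaOdd_apply_zero hx0 hx1]
      push_cast
      ring
  simp_rw [hval]
  rw [generalizedBernoulli_one_eq χ hχ, eq_neg_iff_add_eq_zero, Finset.sum_div,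
    ← Finset.sum_add_distrib]
  have : ∀ j : ZMod M, χ j * (1 / 2 - (j.val : ℂ) / M) + (j.val : ℂ) * χ j / M = χ j * (1 / 2) :=
    fun j ↦ by ring
  simp_rw [this, ← Finset.sum_mul, h0, zero_mul]

end LZero

/-! ### The cusps of the second kind -/

section Cusps

variable {M : ℕ} [NeZero M] (χ : DirichletCharacter ℂ M)

/-- Entries of `v A⁻¹` for `A = (a b; c d) ∈ SL₂(ℤ)`: `(v A⁻¹)₀ = v₀ d - v₁ c`. [folklore] -/
theorem vecMul_inv_apply_zero (v : Fin 2 → ℤ) (A : SL(2, ℤ)) :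
    (v ᵥ* ((A⁻¹ : SL(2, ℤ)) : Matrix (Fin 2) (Fin 2) ℤ)) 0 = v 0 * A 1 1 - v 1 * A 1 0 := by
  rw [Matrix.SpecialLinearGroup.SL2_inv_expl]
  simp [Matrix.vecMul, dotProduct, Fin.sum_univ_two, sub_eq_add_neg]

/-- Entries of `v A⁻¹`: `(v A⁻¹)₁ = -v₀ b + v₁ a`. [folklore] -/
theorem vecMul_inv_apply_one (v : Fin 2 → ℤ) (A : SL(2, ℤ)) :
    (v ᵥ* ((A⁻¹ : SL(2, ℤ)) : Matrix (Fin 2) (Fin 2) ℤ)) 1 = -(v 0 * A 0 1) + v 1 * A 0 0 := by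
  rw [Matrix.SpecialLinearGroup.SL2_inv_expl]
  simp [Matrix.vecMul, dotProduct, Fin.sum_univ_two]

omit [NeZero M] in
/-- The residue class of `r ∈ Fin M` through `ℤ`. [folklore] -/
theorem natCast_fin_val (r : Fin M) : (((((r : ℕ) : ℤ) : ZMod M)).val) = (r : ℕ) := by
  rw [Int.cast_natCast, ZMod.val_natCast, Nat.mod_eq_of_lt r.2]

omit [NeZero M] in
/-- Two elements of `Fin M` with the same residue are equal. [folklore] -/
theorem fin_eq_of_intCast_eq {r r' : Fin M} (h : (((r : ℕ) : ℤ) : ZMod M) = (((r' : ℕ) : ℤ) : ZMod M)) :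
    r = r' := by
  apply Fin.ext
  have := congrArg ZMod.val h
  rwa [natCast_fin_val, natCast_fin_val] at this

/-- **The constant term of `G̃_χ(·,0)` at a cusp `A∞` with `c_A` prime to `M`**:
`heckeOneCusp χ A = (2πi/M) χ̄(c) B_{1,χ}` (odd `χ`). [cite: Hecke1927, §2] -/
theorem heckeOneCusp_of_isUnit (hodd : χ.Odd) {A : SL(2, ℤ)} (hc : IsUnit ((A 1 0 : ℤ) : ZMod M)) :
    heckeOneCusp χ A =
      (2 * π * Complex.I / M) * χ⁻¹ ((A 1 0 : ℤ) : ZMod M) * generalizedBernoulli 1 χ := by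
  have hM : 0 < M := NeZero.pos M
  have hM0 : (M : ℂ) ≠ 0 := by exact_mod_cast NeZero.ne M
  have hχ := ne_one_of_odd χ hodd
  have hM1 : M ≠ 1 := by rintro rfl; exact hχ (DirichletCharacter.level_one χ)
  haveI : Nontrivial (ZMod M) := ZMod.nontrivial_iff.mpr hM1
  -- names for the entries and an inverse of `c` modulo `M`
  set a : ZMod M := ((A 0 0 : ℤ) : ZMod M) with ha
  set b : ZMod M := ((A 0 1 : ℤ) : ZMod M) with hb
  set c : ZMod M := ((A 1 0 : ℤ) : ZMod M) with hcdef
  set d : ZMod M := ((A 1 1 : ℤ) : ZMod M) with hd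
  have hdet : a * d - b * c = 1 := by
    have h := Matrix.SpecialLinearGroup.det_coe A
    rw [Matrix.det_fin_two] at h
    have := congrArg (fun x : ℤ ↦ (x : ZMod M)) h
    push_cast at this
    rw [ha, hb, hcdef, hd]
    linear_combination this
  obtain ⟨cu, hcu⟩ := hc
  set c' : ℤ := (((cu⁻¹ : (ZMod M)ˣ) : ZMod M).val : ℤ) with hc'
  have hcc' : c * (c' : ZMod M) = 1 := by
    rw [hc', Int.cast_natCast, ZMod.natCast_zmod_val, ← hcu, Units.mul_inv]
  have hχc : χ ((c' : ℤ) : ZMod M) = χ⁻¹ c := by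
    rw [MulChar.inv_apply_eq_inv']
    have h1 : χ c * χ ((c' : ℤ) : ZMod M) = 1 := by rw [← map_mul, hcc', map_one]
    exact (eq_inv_of_mul_eq_one_right h1)
  -- the index pair attached to `p₁`
  set p₂ : Fin M → Fin M := fun p₁ ↦ residueFin hM (((p₁ : ℕ) : ℤ) * A 1 1 * c') with hp₂
  have hp₂Z : ∀ p₁ : Fin M, (((p₂ p₁ : ℕ) : ℤ) : ZMod M) = (((p₁ : ℕ) : ℤ) : ZMod M) * d * c' := by
    intro p₁
    have h := dvd_sub_residueFin hM (((p₁ : ℕ) : ℤ) * A 1 1 * c')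
    rw [← ZMod.intCast_zmod_eq_zero_iff_dvd] at h
    rw [hp₂, hd]
    push_cast at h ⊢
    linear_combination -h
  -- unfold the constant and split the double sum
  unfold heckeOneCusp
  rw [← Finset.univ_product_univ, Finset.sum_product]
  -- the inner sums collapse to `p₂ = p₂ p₁`
  have hW : ∀ p₁ q : Fin M, cuspWeight χ A ![((p₁ : ℕ) : ℤ), ((q : ℕ) : ℤ)] =
      if (M : ℤ) ∣ ((p₁ : ℕ) : ℤ) * A 1 1 - ((q : ℕ) : ℤ) * A 1 0 then
        χ (((-(((p₁ : ℕ) : ℤ) * A 0 1) + ((q : ℕ) : ℤ) * A 0 0 : ℤ) : ZMod M)) else 0 := by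
    intro p₁ q
    rw [cuspWeight, allPairsWeight, vecMul_inv_apply_zero, vecMul_inv_apply_one]
    simp only [Matrix.cons_val_zero, Matrix.cons_val_one, Matrix.cons_val_fin_one]
  have hcond : ∀ p₁ q : Fin M, ((M : ℤ) ∣ ((p₁ : ℕ) : ℤ) * A 1 1 - ((q : ℕ) : ℤ) * A 1 0) ↔
      (((p₁ : ℕ) : ℤ) : ZMod M) * d - (((q : ℕ) : ℤ) : ZMod M) * c = 0 := by
    intro p₁ q
    rw [← ZMod.intCast_zmod_eq_zero_iff_dvd]
    push_cast
    rw [hcdef, hd]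
  have hwt : ∀ p₁ q : Fin M, χ (((-(((p₁ : ℕ) : ℤ) * A 0 1) + ((q : ℕ) : ℤ) * A 0 0 : ℤ) : ZMod M)) =
      χ (-((((p₁ : ℕ) : ℤ) : ZMod M) * b) + (((q : ℕ) : ℤ) : ZMod M) * a) := by
    intro p₁ q
    push_cast
    rw [ha, hb]
  have hinner : ∀ p₁ : Fin M, ∑ q : Fin M, cuspWeight χ A ![((p₁ : ℕ) : ℤ), ((q : ℕ) : ℤ)] *
      congrConst M ![((p₁ : ℕ) : ℤ), ((q : ℕ) : ℤ)] =
      χ ((((p₁ : ℕ) : ℤ) : ZMod M) * c') *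
        congrConst M ![((p₁ : ℕ) : ℤ), ((p₂ p₁ : ℕ) : ℤ)] := by
    intro p₁
    rw [Finset.sum_eq_single (p₂ p₁)]
    · rw [hW, if_pos, hwt, hp₂Z]
      · congr 2
        linear_combination (((p₁ : ℕ) : ℤ) : ZMod M) * (c' : ZMod M) * hdet +
          (((p₁ : ℕ) : ℤ) : ZMod M) * b * hcc'
      · rw [hcond, hp₂Z]
        linear_combination (-((((p₁ : ℕ) : ℤ) : ZMod M) * d)) * hcc'
    · intro q _ hq
      rw [hW, if_neg, zero_mul]
      intro h0
      rw [hcond] at h0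
      apply hq
      apply fin_eq_of_intCast_eq
      rw [hp₂Z]
      linear_combination (-(((q : ℕ) : ℤ) : ZMod M)) * hcc' - (c' : ZMod M) * h0
    · intro h; exact absurd (Finset.mem_univ _) h
  simp_rw [hinner]
  -- the first-kind terms vanish; evaluate the second kind
  have hterm : ∀ p₁ : Fin M, χ ((((p₁ : ℕ) : ℤ) : ZMod M) * c') *
      congrConst M ![((p₁ : ℕ) : ℤ), ((p₂ p₁ : ℕ) : ℤ)] =
      (M : ℂ)⁻¹ * (2 * (-Complex.I * π)) * χ ((c' : ℤ) : ZMod M) *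
        (χ ((((p₁ : ℕ) : ℤ) : ZMod M)) *
          hurwitzZetaOdd (ZMod.toAddCircle ((((p₁ : ℕ) : ℤ) : ZMod M))) 0) := by
    intro p₁
    rw [congrConst]
    simp only [Matrix.cons_val_zero, Matrix.cons_val_one, Matrix.cons_val_fin_one]
    have hto : ZMod.toAddCircle ((((p₁ : ℕ) : ℤ) : ZMod M)) =
        ((((((p₁ : ℕ) : ℤ) : ℝ)) / (M : ℝ) : ℝ) : UnitAddCircle) := by
      rw [ZMod.toAddCircle_apply, natCast_fin_val]; push_cast; rfl
    rw [hto, map_mul]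
    by_cases h0 : (M : ℤ) ∣ ((p₁ : ℕ) : ℤ)
    · -- `p₁ = 0`: both sides vanish as `χ(0) = 0`
      have hp0 : (((p₁ : ℕ) : ℤ) : ZMod M) = 0 := (ZMod.intCast_zmod_eq_zero_iff_dvd _ M).mpr h0
      rw [hp0, MulChar.map_zero]
      ring
    · rw [if_neg h0]
      ring
  simp_rw [hterm]
  rw [← Finset.mul_sum, sum_fin_eq_sum_zmod (fun x : ZMod M ↦ χ x * hurwitzZetaOdd (ZMod.toAddCircle x) 0),
    sum_mul_hurwitzZetaOdd_zero χ hodd, hχc]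
  field_simp

end Cusps

end Literature.NumberTheory.EllipticCurves.ModularForms
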